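import Literature.NumberTheory.LFunctions.KMVCompletedLHalfIntegral
import Literature.NumberTheory.EllipticCurves.CuspFormLDerivativeSeries
import Literature.Analysis.SpecialFunctions.MellinIteratedDeriv
import Mathlib.Analysis.SpecialFunctions.Gamma.Beta
import HarnessLib

/-!
# KMV 2000 (13) at the centre, every order: `Λ^{(k)}(f, ½) = 2π q̂^{1/2} ∫_0^∞ f(iy) (log(√N y))^k dy`
# (stub T1 of the fact skeleton `log-fricke-split` for `KMV2000.kmv2000_eq22`)

Source: E. Kowalski, P. Michel, J. VanderKam, J. reine angew. Math. 526 (2000), p. 1 (definition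
`Λ(f,s) = q̂^s Γ(s+½) L(f,s)`, `q̂ = √q/2π`) and (13) p. 9 [held: paper:doi-10-1515-crll-2000-074].
Cell landau-siegel / ls-inputs, line H-AFE2 (K-INPUTS-11 (1)), seat ls-inputs-Hafe-lead g1. Proofs only.

With `F(y) = f(iy)` and `F_N(t) = F(t/√N)`: the entire continuation of record is
`L^*(f,s) = (2π)^s Γ(s)⁻¹ 𝓜F(s)` (`GL2Family.entireLSeries_cuspCoeff_eq_cuspFormLStar`), and
`𝓜F(s') = (√N)^{−s'} 𝓜F_N(s')` (`mellin_comp_mul_left`), so on the half-plane `Re s > −½`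
(`Γ(s+½) ≠ 0`)

  `Λ(f, s) = q̂^s (2π)^{s+½} (√N)^{−(s+½)} 𝓜F_N(s+½) = (2π/√N)^{1/2} 𝓜F_N(s+½)`   (`q̂ · 2π · (√N)⁻¹ = 1`).

`F_N` decays to every order at `0⁺` and `+∞` (tree: `isBigO_imagAxis_nhdsGT_zero`,
`exists_isBigO_imagAxis_atTop`), so the tree's `iteratedDeriv_mellin_eq_of_isBigO_rpow` gives
`Λ^{(k)}(f,½) = (2π/√N)^{1/2} ∫_0^∞ (log t)^k F(t/√N) dt = 2π q̂^{1/2} ∫_0^∞ F(y)(log(√N y))^k dy`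
(`t = √N y`), together with the integrability of `y ↦ F(y)(log(√N y))^k` on `(0,∞)`.

* `KMV2000.integrableOn_imagAxis_mul_logPow`, `KMV2000.derivLambda_eq_integral` (every level `N ≥ 1`);
* `KMV2000.derivLambda_eq_integral_all` — the registered quantifier shape of stub T1 (verbatim).

No claim about Landau–Siegel zeros.
-/

noncomputable section

open scoped Real
open Complex Set MeasureTheory Filter Asymptotics CongruenceSubgroup
open _root_.Topology
open Literature.NumberTheory.EllipticCurves.ModularForms

namespace Literature.NumberTheory.LFunctions.KMV2000

variable {N : ℕ} [NeZero N]

/-! ### The scaled axis function `F_N(t) = f(it/√N)` and its two-sided decay -/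

/-- `F_N(t) = f(i t/√N)` is locally integrable on `(0,∞)`. [cite: KowalskiMichelVanderKam2000, (13) p. 9] -/
theorem locallyIntegrableOn_imagAxis_scaled (f : CuspForm (Gamma0 N) 2) :
    LocallyIntegrableOn (fun t : ℝ ↦ f (UpperHalfPlane.ofComplex (Complex.I * (((Real.sqrt N)⁻¹ * t : ℝ) : ℂ))))
      (Ioi 0) := by
  have hs : 0 < (Real.sqrt N)⁻¹ := inv_pos.mpr (Real.sqrt_pos.mpr (by exact_mod_cast NeZero.pos N))
  have hc : ContinuousOn ((f : UpperHalfPlane → ℂ) ∘ UpperHalfPlane.ofComplex) {z : ℂ | 0 < z.im} :=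
    (UpperHalfPlane.mdifferentiable_iff.mp (CuspFormClass.holo f)).continuousOn
  have h2 : ContinuousOn (fun t : ℝ ↦ Complex.I * (((Real.sqrt N)⁻¹ * t : ℝ) : ℂ)) (Ioi 0) := by fun_prop
  refine (hc.comp h2 fun t ht ↦ ?_).locallyIntegrableOn measurableSet_Ioi
  have ht : (0 : ℝ) < t := ht
  simp only [Set.mem_setOf_eq, Complex.mul_im, Complex.I_re, Complex.I_im, Complex.ofReal_re,
    Complex.ofReal_im, zero_mul, one_mul, zero_add]
  positivity

/-- `F_N` decays to every order at `+∞` (exponential decay of a cusp form up the axis).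
[cite: KowalskiMichelVanderKam2000, (13) p. 9] -/
theorem isBigO_imagAxis_scaled_atTop (f : CuspForm (Gamma0 N) 2) (r : ℝ) :
    (fun t : ℝ ↦ f (UpperHalfPlane.ofComplex (Complex.I * (((Real.sqrt N)⁻¹ * t : ℝ) : ℂ)))) =O[atTop] (· ^ r) := by
  have hs : 0 < (Real.sqrt N)⁻¹ := inv_pos.mpr (Real.sqrt_pos.mpr (by exact_mod_cast NeZero.pos N))
  obtain ⟨c, hc, htop⟩ := exists_isBigO_imagAxis_atTop f
  have hg : Tendsto (fun t : ℝ ↦ (Real.sqrt N)⁻¹ * t) atTop atTop := tendsto_id.const_mul_atTop hs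
  have h1 := htop.comp_tendsto hg
  have h2 : (fun t : ℝ ↦ Real.exp (-c * ((Real.sqrt N)⁻¹ * t))) =O[atTop] (· ^ r) := by
    have h := (isLittleO_exp_neg_mul_rpow_atTop (mul_pos hc hs) r).isBigO
    refine h.congr_left fun t ↦ ?_
    ring_nf
  exact h1.trans h2

/-- `F_N` decays to every order at `0⁺` (rapid decay of a cusp form down the axis).
[cite: KowalskiMichelVanderKam2000, (13) p. 9] -/
theorem isBigO_imagAxis_scaled_nhdsGT_zero (f : CuspForm (Gamma0 N) 2) (r : ℝ) :
    (fun t : ℝ ↦ f (UpperHalfPlane.ofComplex (Complex.I * (((Real.sqrt N)⁻¹ * t : ℝ) : ℂ)))) =O[𝓝[>] 0] (· ^ r) := by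
  have hs : 0 < (Real.sqrt N)⁻¹ := inv_pos.mpr (Real.sqrt_pos.mpr (by exact_mod_cast NeZero.pos N))
  have hbot := isBigO_imagAxis_nhdsGT_zero f (-r)
  have hg : Tendsto (fun t : ℝ ↦ (Real.sqrt N)⁻¹ * t) (𝓝[>] 0) (𝓝[>] 0) := by
    refine tendsto_nhdsWithin_iff.mpr ⟨?_, ?_⟩
    · have h : Tendsto (fun t : ℝ ↦ (Real.sqrt N)⁻¹ * t) (𝓝 0) (𝓝 ((Real.sqrt N)⁻¹ * 0)) :=
        tendsto_const_nhds.mul tendsto_id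
      rw [mul_zero] at h
      exact h.mono_left nhdsWithin_le_nhds
    · filter_upwards [self_mem_nhdsWithin] with t ht
      exact mul_pos hs ht
  have h1 := hbot.comp_tendsto hg
  refine h1.trans ?_
  refine IsBigO.of_bound (((Real.sqrt N)⁻¹) ^ r) ?_
  filter_upwards [self_mem_nhdsWithin] with t ht
  have ht : (0 : ℝ) < t := ht
  simp only [Function.comp, neg_neg]
  rw [Real.norm_of_nonneg (Real.rpow_nonneg (by positivity) _), Real.norm_of_nonneg (Real.rpow_nonneg ht.le _),
    Real.mul_rpow hs.le ht.le]

/-! ### Integrability of `f(iy)(log √N y)^k` -/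

/-- `y ↦ f(iy) (log(√N y))^k` is integrable on `(0, ∞)` (Mellin convergence of `(log t)^k F_N(t)` at
`s = 1`, then `t = √N y`). [cite: KowalskiMichelVanderKam2000, (13) p. 9] -/
theorem integrableOn_imagAxis_mul_logPow (f : CuspForm (Gamma0 N) 2) (k : ℕ) :
    IntegrableOn (fun y : ℝ ↦ f (UpperHalfPlane.ofComplex (Complex.I * y)) *
      (((Real.log (Real.sqrt N * y)) ^ k : ℝ) : ℂ)) (Ioi 0) := by
  have hsN : 0 < Real.sqrt N := Real.sqrt_pos.mpr (by exact_mod_cast NeZero.pos N)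
  have hM := Literature.Analysis.SpecialFunctions.mellinConvergent_log_pow_smul_of_isBigO_rpow
    (locallyIntegrableOn_imagAxis_scaled f) (isBigO_imagAxis_scaled_atTop f)
    (isBigO_imagAxis_scaled_nhdsGT_zero f) k 1
  rw [MellinConvergent] at hM
  -- `t = √N y`
  have h2 := (integrableOn_Ioi_comp_mul_left_iff (fun t : ℝ ↦ (t : ℂ) ^ ((1 : ℂ) - 1) •
      (((Real.log t) ^ k : ℝ) • f (UpperHalfPlane.ofComplex (Complex.I * (((Real.sqrt N)⁻¹ * t : ℝ) : ℂ)))))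
    0 hsN).mpr (by rw [mul_zero]; exact hM)
  refine IntegrableOn.congr_fun h2 (fun y hy ↦ ?_) measurableSet_Ioi
  have hy : (0 : ℝ) < y := hy
  have hyy : (Real.sqrt N)⁻¹ * (Real.sqrt N * y) = y := by field_simp
  simp only [sub_self, Complex.cpow_zero, one_smul, hyy, Complex.real_smul]
  ring

/-! ### The Mellin form of `Λ(f, s)` on `Re s > −½` -/

/-- `q̂ · 2π · (√N)⁻¹ = 1`. [cite: KowalskiMichelVanderKam2000, §1 p. 1 (definition of q̂)] -/
theorem qhat_mul_two_pi_mul_inv_sqrt : qhat N * (2 * π) * (Real.sqrt N)⁻¹ = 1 := by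
  have hsN : 0 < Real.sqrt N := Real.sqrt_pos.mpr (by exact_mod_cast NeZero.pos N)
  rw [qhat]
  field_simp

/-- **`Λ(f, s) = (2π/√N)^{1/2} 𝓜F_N(s + ½)`** for `Re s > −½`, `F_N(t) = f(it/√N)` (the entire
continuation of record is `L^*(f,·)`, a Mellin transform; `q̂ · 2π · (√N)⁻¹ = 1`).
[cite: KowalskiMichelVanderKam2000, §1 p. 1 (definition of Λ) and (13) p. 9] -/
theorem completedL_eq_mellin_scaled (f : CuspForm (Gamma0 N) 2) {s : ℂ} (hs : -(1 / 2 : ℝ) < s.re) :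
    completedL N f s = (((2 * π * (Real.sqrt N)⁻¹ : ℝ) : ℂ) ^ (1 / 2 : ℂ)) *
      mellin (fun t : ℝ ↦ f (UpperHalfPlane.ofComplex (Complex.I * (((Real.sqrt N)⁻¹ * t : ℝ) : ℂ))))
        (s + 1 / 2) := by
  have hsN : 0 < Real.sqrt N := Real.sqrt_pos.mpr (by exact_mod_cast NeZero.pos N)
  have hc : 0 < (Real.sqrt N)⁻¹ := inv_pos.mpr hsN
  have hq : 0 < qhat N := by rw [qhat]; positivity
  have hΓ : Complex.Gamma (s + 1 / 2) ≠ 0 := Complex.Gamma_ne_zero_of_re_pos (by simp; linarith)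
  have h := GL2Family.entireLSeries_cuspCoeff_eq_cuspFormLStar f
  norm_num at h
  rw [completedL, h, GL2Family.cuspFormLStar_def, GL2Family.cuspFormMellin_def]
  -- `𝓜F(s') = c^{s'} 𝓜F_N(s')`, `c = (√N)⁻¹`
  have hscale := mellin_comp_mul_left (fun t : ℝ ↦ f (UpperHalfPlane.ofComplex (Complex.I * (t : ℂ))))
    (s + 1 / 2) hc
  have hF : mellin (fun t : ℝ ↦ f (UpperHalfPlane.ofComplex (Complex.I * (t : ℂ)))) (s + 1 / 2) =
      (((Real.sqrt N)⁻¹ : ℝ) : ℂ) ^ (s + 1 / 2) *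
        mellin (fun t : ℝ ↦ f (UpperHalfPlane.ofComplex (Complex.I * ((((Real.sqrt N)⁻¹ * t : ℝ)) : ℂ))))
          (s + 1 / 2) := by
    have hne : (((Real.sqrt N)⁻¹ : ℝ) : ℂ) ^ (-(s + 1 / 2)) ≠ 0 := by
      rw [Ne, Complex.cpow_eq_zero_iff, not_and_or]
      exact Or.inl (ofReal_ne_zero.mpr hc.ne')
    have h2 : (fun t : ℝ ↦ f (UpperHalfPlane.ofComplex (Complex.I * ((((Real.sqrt N)⁻¹ * t : ℝ)) : ℂ)))) =
        fun t : ℝ ↦ (fun u : ℝ ↦ f (UpperHalfPlane.ofComplex (Complex.I * (u : ℂ)))) ((Real.sqrt N)⁻¹ * t) := by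
      funext t; rfl
    rw [h2, hscale, smul_eq_mul, ← mul_assoc, ← Complex.cpow_add _ _ (ofReal_ne_zero.mpr hc.ne'),
      add_neg_cancel, Complex.cpow_zero, one_mul]
  rw [hF]
  -- constants: `q̂^s (2π)^{s+½} c^{s+½} = (2π c)^{1/2}` since `q̂ · 2π · c = 1`
  have h2π : ((2 * π : ℝ) : ℂ) ≠ 0 := ofReal_ne_zero.mpr (by positivity)
  have hcC : (((Real.sqrt N)⁻¹ : ℝ) : ℂ) ≠ 0 := ofReal_ne_zero.mpr hc.ne'
  have h2πnn : (0 : ℝ) ≤ 2 * π := by positivity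
  have hq2π : (0 : ℝ) ≤ qhat N * (2 * π) := mul_nonneg hq.le h2πnn
  have hprod : ((qhat N : ℝ) : ℂ) ^ s * ((2 * π : ℝ) : ℂ) ^ s * (((Real.sqrt N)⁻¹ : ℝ) : ℂ) ^ s = 1 := by
    rw [← Complex.mul_cpow_ofReal_nonneg hq.le h2πnn, ← Complex.ofReal_mul,
      ← Complex.mul_cpow_ofReal_nonneg hq2π hc.le, ← Complex.ofReal_mul, qhat_mul_two_pi_mul_inv_sqrt,
      Complex.ofReal_one, Complex.one_cpow]
  have hsplit1 : ((2 * π : ℝ) : ℂ) ^ (s + 1 / 2) = ((2 * π : ℝ) : ℂ) ^ s * ((2 * π : ℝ) : ℂ) ^ (1 / 2 : ℂ) :=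
    Complex.cpow_add _ _ h2π
  have hsplit2 : (((Real.sqrt N)⁻¹ : ℝ) : ℂ) ^ (s + 1 / 2) =
      (((Real.sqrt N)⁻¹ : ℝ) : ℂ) ^ s * (((Real.sqrt N)⁻¹ : ℝ) : ℂ) ^ (1 / 2 : ℂ) :=
    Complex.cpow_add _ _ hcC
  have hhalf : ((2 * π : ℝ) : ℂ) ^ (1 / 2 : ℂ) * (((Real.sqrt N)⁻¹ : ℝ) : ℂ) ^ (1 / 2 : ℂ) =
      ((2 * π * (Real.sqrt N)⁻¹ : ℝ) : ℂ) ^ (1 / 2 : ℂ) := by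
    rw [← Complex.mul_cpow_ofReal_nonneg (by positivity) hc.le]
    push_cast
    ring_nf
  have h2πc : (2 * (π : ℂ)) = ((2 * π : ℝ) : ℂ) := by push_cast; ring
  set M : ℂ := mellin (fun t : ℝ ↦ f (UpperHalfPlane.ofComplex (Complex.I * ((((Real.sqrt N)⁻¹ * t : ℝ)) : ℂ))))
    (s + 1 / 2) with hM
  set G : ℂ := Complex.Gamma (s + 1 / 2) with hG
  rw [h2πc]
  have key : ((qhat N : ℝ) : ℂ) ^ s * G *
      (((2 * π : ℝ) : ℂ) ^ (s + 1 / 2) / G * ((((Real.sqrt N)⁻¹ : ℝ) : ℂ) ^ (s + 1 / 2) * M)) =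
      (((qhat N : ℝ) : ℂ) ^ s * ((2 * π : ℝ) : ℂ) ^ s * (((Real.sqrt N)⁻¹ : ℝ) : ℂ) ^ s) *
        ((((2 * π : ℝ) : ℂ) ^ (1 / 2 : ℂ) * (((Real.sqrt N)⁻¹ : ℝ) : ℂ) ^ (1 / 2 : ℂ)) * M) := by
    rw [hsplit1, hsplit2]
    field_simp
  rw [key, hprod, one_mul, hhalf]

/-! ### The derivative formula -/

/-- **`Λ^{(k)}(f, ½) = 2π q̂^{1/2} ∫_0^∞ f(iy) (log(√N y))^k dy`** for every `f ∈ S₂(Γ₀(N))`, `N ≥ 1`,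
`k ≥ 0` (differentiate `Λ(f,s) = (2π/√N)^{1/2} 𝓜F_N(s+½)` `k` times under the Mellin integral and
substitute `t = √N y`; at `k = 0` this is `completedL_half_eq_integral`).
[cite: KowalskiMichelVanderKam2000, (13) p. 9 (with p. 1, definition of Λ)] -/
theorem derivLambda_eq_integral (f : CuspForm (Gamma0 N) 2) (k : ℕ) :
    derivLambda N k f =
      2 * (π : ℂ) * ((qhat N : ℝ) : ℂ) ^ (1 / 2 : ℂ) *
        ∫ y in Ioi (0 : ℝ), f (UpperHalfPlane.ofComplex (Complex.I * y)) *
          (((Real.log (Real.sqrt N * y)) ^ k : ℝ) : ℂ) := by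
  have hsN : 0 < Real.sqrt N := Real.sqrt_pos.mpr (by exact_mod_cast NeZero.pos N)
  have hc : 0 < (Real.sqrt N)⁻¹ := inv_pos.mpr hsN
  have hq : 0 < qhat N := by rw [qhat]; positivity
  set FN : ℝ → ℂ := fun t : ℝ ↦ f (UpperHalfPlane.ofComplex (Complex.I * ((((Real.sqrt N)⁻¹ * t : ℝ)) : ℂ)))
    with hFN
  set C₀ : ℂ := ((2 * π * (Real.sqrt N)⁻¹ : ℝ) : ℂ) ^ (1 / 2 : ℂ) with hC₀
  -- Step 1: `Λ = C₀ · 𝓜F_N(· + ½)` on the open half-plane `Re s > −½`, hence equal `k`-th derivatives at `½`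
  have hopen : IsOpen {s : ℂ | -(1 / 2 : ℝ) < s.re} := isOpen_lt continuous_const Complex.continuous_re
  have heq : Set.EqOn (completedL N f) (fun s : ℂ ↦ C₀ * mellin FN (s + 1 / 2)) {s : ℂ | -(1 / 2 : ℝ) < s.re} :=
    fun s hs ↦ completedL_eq_mellin_scaled f hs
  have hmem : (1 / 2 : ℂ) ∈ {s : ℂ | -(1 / 2 : ℝ) < s.re} := by
    simp only [Set.mem_setOf_eq]; norm_num
  rw [derivLambda, heq.iteratedDeriv_of_isOpen hopen k hmem]
  -- Step 2: pull the constant and the shift through the iterated derivative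
  have hshift : iteratedDeriv k (fun s : ℂ ↦ C₀ * mellin FN (s + 1 / 2)) (1 / 2) =
      C₀ * iteratedDeriv k (mellin FN) 1 := by
    rw [iteratedDeriv_const_mul_field]
    have h := congrFun (iteratedDeriv_comp_add_const k (mellin FN) (1 / 2 : ℂ)) (1 / 2 : ℂ)
    rw [h]
    norm_num
  rw [hshift]
  -- Step 3: differentiate under the Mellin integral
  rw [Literature.Analysis.SpecialFunctions.iteratedDeriv_mellin_eq_of_isBigO_rpow
    (locallyIntegrableOn_imagAxis_scaled f) (isBigO_imagAxis_scaled_atTop f)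
    (isBigO_imagAxis_scaled_nhdsGT_zero f) k 1, mellin]
  -- Step 4: substitute `t = √N y`
  have hsub := integral_comp_mul_left_Ioi (fun t : ℝ ↦ (t : ℂ) ^ ((1 : ℂ) - 1) •
      (((Real.log t) ^ k : ℝ) • FN t)) 0 hsN
  rw [mul_zero] at hsub
  have hint : ∫ t in Ioi (0 : ℝ), (t : ℂ) ^ ((1 : ℂ) - 1) • (((Real.log t) ^ k : ℝ) • FN t) =
      ((Real.sqrt N : ℝ) : ℂ) * ∫ y in Ioi (0 : ℝ), f (UpperHalfPlane.ofComplex (Complex.I * y)) *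
        (((Real.log (Real.sqrt N * y)) ^ k : ℝ) : ℂ) := by
    have hsC : ((Real.sqrt N : ℝ) : ℂ) ≠ 0 := ofReal_ne_zero.mpr hsN.ne'
    have h1 : ∫ x in Ioi (0 : ℝ), ((Real.sqrt N * x : ℝ) : ℂ) ^ ((1 : ℂ) - 1) •
        (((Real.log (Real.sqrt N * x)) ^ k : ℝ) • FN (Real.sqrt N * x)) =
        ∫ y in Ioi (0 : ℝ), f (UpperHalfPlane.ofComplex (Complex.I * y)) *
          (((Real.log (Real.sqrt N * y)) ^ k : ℝ) : ℂ) := by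
      refine setIntegral_congr_fun measurableSet_Ioi fun y hy ↦ ?_
      have hy : (0 : ℝ) < y := hy
      have hyy : (Real.sqrt N)⁻¹ * (Real.sqrt N * y) = y := by field_simp
      simp only [hFN, sub_self, Complex.cpow_zero, one_smul, hyy, Complex.real_smul]
      ring
    rw [← h1, hsub, Complex.real_smul, Complex.ofReal_inv, ← mul_assoc, mul_inv_cancel₀ hsC, one_mul]
  rw [hint, ← mul_assoc]
  congr 1
  -- Step 5: the constant `C₀ √N = 2π q̂^{1/2}`
  have hhalf : (1 / 2 : ℂ) = ((1 / 2 : ℝ) : ℂ) := by push_cast; ring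
  rw [hC₀, hhalf, ← Complex.ofReal_cpow (by positivity) (1 / 2), ← Complex.ofReal_cpow hq.le (1 / 2)]
  have hreal : (2 * π * (Real.sqrt N)⁻¹) ^ (1 / 2 : ℝ) * Real.sqrt N = 2 * π * qhat N ^ (1 / 2 : ℝ) := by
    rw [← Real.sqrt_eq_rpow, ← Real.sqrt_eq_rpow, qhat, ← div_eq_mul_inv,
      Real.sqrt_div' _ hsN.le, Real.sqrt_div' _ (by positivity : (0 : ℝ) ≤ 2 * π)]
    have h1 : Real.sqrt (Real.sqrt N) ≠ 0 := (Real.sqrt_pos.mpr hsN).ne'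
    have h2 : Real.sqrt (2 * π) ≠ 0 := (Real.sqrt_pos.mpr (by positivity)).ne'
    have e1 : Real.sqrt N = Real.sqrt (Real.sqrt N) * Real.sqrt (Real.sqrt N) :=
      (Real.mul_self_sqrt hsN.le).symm
    have e2 : (2 * π) = Real.sqrt (2 * π) * Real.sqrt (2 * π) :=
      (Real.mul_self_sqrt (by positivity : (0 : ℝ) ≤ 2 * π)).symm
    field_simp
    nlinarith [e1, e2, Real.sqrt_nonneg (Real.sqrt N), Real.sqrt_nonneg (2 * π)]
  have h := congrArg (fun x : ℝ ↦ (x : ℂ)) hreal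
  push_cast at h ⊢
  rw [h]

/-- Stub **T1** of the fact skeleton `log-fricke-split` (crux workfile
`Cruxes/BeyondDiagonalBeatsQuarter/Lines/log_fricke_split.lean` on stmt-Parity-20343), in its registered
quantifier shape: integrability of `f(iy)(log √N y)^k` and the derivative formula.
[cite: KowalskiMichelVanderKam2000, (13) p. 9] -/
theorem derivLambda_eq_integral_all :
    ∀ (N : ℕ) [NeZero N] (f : CuspForm (Gamma0 N) 2) (k : ℕ),
      IntegrableOn (fun y : ℝ ↦ f (UpperHalfPlane.ofComplex (Complex.I * y)) *
          (((Real.log (Real.sqrt N * y)) ^ k : ℝ) : ℂ)) (Ioi 0) ∧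
      KMV2000.derivLambda N k f =
        2 * (π : ℂ) * ((KMV2000.qhat N : ℝ) : ℂ) ^ (1 / 2 : ℂ) *
          ∫ y in Ioi (0 : ℝ), f (UpperHalfPlane.ofComplex (Complex.I * y)) *
            (((Real.log (Real.sqrt N * y)) ^ k : ℝ) : ℂ) :=
  fun _ _ f k ↦ ⟨integrableOn_imagAxis_mul_logPow f k, derivLambda_eq_integral f k⟩

end Literature.NumberTheory.LFunctions.KMV2000

end
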